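import Literature.Barriers.RiemannHypothesis.BeurlingCounterexamplesProofs
import Literature.NumberTheory.BeurlingPrimes.DeletedPrimes
import Literature.NumberTheory.BeurlingPrimes.IntCountBasic
import Mathlib.Analysis.SpecialFunctions.Pow.Asymptotics
import HarnessLib

/-!
# Broucke–Debruyne–Révész 2023, Theorem 1.3, second assertion: reduction to the analytic input of §5

Sibling file of `BeurlingCounterexamples.lean` / `BeurlingCounterexamplesProofs.lean` for the named
fact `Literature.Barriers.RiemannHypothesis.BrouckeDebruyneRevesz2023_thm13b` ("Assume RH. Then there
exists … an `[α, β]`-system for `1/2 < α < 2/3` and `2α/(α + 2) ≤ β < 1/2`", arXiv:2309.01567,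
Theorem 1.3). The printed proof (§5 pp. 15–17) has two layers:

1. **Analytic input** (random prime selection by the proof of the Broucke–Vindas discretization
   Theorem 1.2 applied to `dF = u^{α−1} d(π + E)(u)`, the estimate
   `log ζ_𝒮(s) = log ζ(s + 1 − α) + O_ε(√log|t|)` on `Re s ≥ α/2 + ε`, and Perron inversion for
   `ζ_𝒮`, `ζ_𝒮 + 1/ζ_𝒮` under RH): a set `𝒫_𝒮` of rational primes with `π_𝒮(x) ≍ x^α/log x` whose
   `𝒫_𝒮`-free integers satisfy `N'(x) = x/ζ_𝒮(1) + O_ε(x^{2α/(α+2)+ε})`, with the non-vanishing of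
   the second-order coefficients `ζ(β)/ζ_𝒮(β)`. None of this is in the tree; it is vendored below
   as explicit HYPOTHESES of the assembly theorems (no named fact is introduced), clause by clause with
   its locator.
2. **Elementary assembly** (this file, PROVED): the system `𝒫_{α,β} = ℙ ∪ ℙ^{1/β} ∖ 𝒫_𝒮`
   (`Literature.NumberTheory.BeurlingPrimes.delSystem`) is an `[α, β]`-system: the primes by von Koch's
   theorem under RH and `ψ_𝒮(x) ≍ x^α` (`delSystem_primeErrorLE`, `not_delSystem_primeErrorLE`); the
   integers are `β`-well-behaved by a direct summation over `m ≤ x^β`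
   (`delSystem_intErrorLE`, the printed "even simpler means"), and not better by the hyperbola
   Lemma 5.1 (`Literature.NumberTheory.BeurlingPrimes.hyperbola_lemma`) with the non-zero
   second-order term `I(β) x^β` for `β > 2α/(α+2)` (`not_delSystem_intErrorLE`), resp. by the cited
   pole argument at `β = 2α/(α+2)`.

Results: `isSystem_delSystem_of_estimates` (the system `𝒫_{α,β}` is an `[α, β]`-system given the
§5 estimates for `𝒫_𝒮`), `BrouckeDebruyneRevesz2023_thm13b_of_estimates` and
`BrouckeDebruyneRevesz2023_thm13_of_estimates` (the vendored Theorem 1.3 from those estimates alone,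
its first assertion being proved in `BeurlingCounterexamplesProofs.lean`).

## References
* [BrouckeDebruyneRevesz2023] F. Broucke, G. Debruyne, Sz. Gy. Révész, *Some examples of well-behaved
  Beurling number systems*, arXiv:2309.01567, Trans. Amer. Math. Soc. (2024) (read, arXiv version:
  Theorem 1.2, Theorem 1.3, Lemma 5.1, §5 pp. 14–18 incl. Remarks 5.2–5.3).
* [BrouckeVindas2024] F. Broucke, J. Vindas, *A new generalized prime random approximation procedure
  and some of its applications*, Math. Z. 307 (2024), arXiv:2102.08478, Theorem 1.2 (the discretization
  theorem, as quoted in [BrouckeDebruyneRevesz2023, Theorem 1.2]).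
-/

noncomputable section

open Filter Set Asymptotics
open scoped Topology Chebyshev

namespace Literature.Barriers.RiemannHypothesis

open Literature.NumberTheory.BeurlingPrimes Literature.NumberTheory.LFunctions

/-! ### Infinitely many primes are kept -/

/-- If `π_𝒮(x) ≪ x^α/log x` with `α < 1` then infinitely many rational primes lie outside `S`
(Chebyshev: `ϑ(x) ≫ x`, while `ϑ(x) ≤ π(x) log x`). [folklore] -/
theorem keptIdx_infinite {S : Set ℕ} (hS : ∀ p ∈ S, p.Prime) {α C x₀ : ℝ} (hα1 : α < 1)
    (hπ : ∀ x : ℝ, x₀ ≤ x → (primeCountIn S x : ℝ) ≤ C * (x ^ α / Real.log x)) :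
    (keptIdx S).Infinite := by
  classical
  intro hfin
  set K : ℕ := hfin.toFinset.card with hK
  -- `π(y) ≤ K + π_𝒮(y)`
  have hcount : ∀ y : ℝ, (ratPrimes.indexOf y : ℝ) ≤ K + primeCountIn S y := by
    intro y
    have h1 := Finset.card_filter_add_card_filter_not (s := Finset.range (ratPrimes.indexOf y))
      (fun j ↦ j ∈ keptIdx S)
    have h2 : ((Finset.range (ratPrimes.indexOf y)).filter (fun j ↦ j ∈ keptIdx S)).card ≤ K :=
      Finset.card_le_card fun j hj ↦ hfin.mem_toFinset.mpr (Finset.mem_filter.mp hj).2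
    have h3 : ((Finset.range (ratPrimes.indexOf y)).filter (fun j ↦ ¬ j ∈ keptIdx S)).card = primeCountIn S y := by
      rw [← card_filter_delIdx hS y]
      congr 1
      refine Finset.filter_congr fun j _ ↦ ?_
      simp [keptIdx, delIdx]
    rw [Finset.card_range] at h1
    have : ratPrimes.indexOf y ≤ K + primeCountIn S y := by omega
    exact_mod_cast this
  -- `θ(y) ≤ K log y + C y^α` for `y ≥ max x₀ 2`
  have hθle : ∀ y : ℝ, max x₀ 2 ≤ y → θ y ≤ K * Real.log y + C * y ^ α := by
    intro y hy
    have hy2 : 2 ≤ y := le_trans (le_max_right _ _) hy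
    have hlog : 0 < Real.log y := Real.log_pos (by linarith)
    have h1 := theta_le_indexOf_mul_log y
    have h2 := hcount y
    have h3 := hπ y (le_trans (le_max_left _ _) hy)
    calc θ y ≤ (ratPrimes.indexOf y : ℝ) * Real.log y := h1
      _ ≤ (K + primeCountIn S y) * Real.log y := mul_le_mul_of_nonneg_right h2 hlog.le
      _ ≤ (K + C * (y ^ α / Real.log y)) * Real.log y := by gcongr
      _ = K * Real.log y + C * y ^ α := by field_simp
  -- `θ(y) ≥ (y−1) log 2 − log(y+2) − 2√y log y` (Chebyshev), and everything but `y log 2` is `o(y)`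
  set θ₀ : ℝ := max (3 / 4) α with hθ₀
  have hθ₀1 : θ₀ < 1 := max_lt (by norm_num) hα1
  have hθ₀a : α ≤ θ₀ := le_max_right _ _
  have hθ₀b : (3 / 4 : ℝ) ≤ θ₀ := le_max_left _ _
  set M : ℝ := 12 + 4 * K + |C| with hM
  have hM0 : 0 ≤ M := by rw [hM]; positivity
  have hmain : ∀ y : ℝ, max x₀ 2 ≤ y → y * Real.log 2 ≤ 2 * Real.log 2 + M * y ^ θ₀ := by
    intro y hy
    have hy2 : 2 ≤ y := le_trans (le_max_right _ _) hy
    have hy1 : 1 ≤ y := by linarith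
    have hy0 : 0 < y := by linarith
    have hlog0 : 0 ≤ Real.log y := Real.log_nonneg hy1
    have h1 := hθle y hy
    have h2 := Chebyshev.theta_ge' hy1
    -- `log y ≤ 4 y^{1/4}`
    have hl4 : Real.log y ≤ 4 * y ^ (1 / 4 : ℝ) := by
      have := Real.log_le_rpow_div hy0.le (by norm_num : (0 : ℝ) < 1 / 4)
      linarith [this]
    have hq : y ^ (1 / 4 : ℝ) ≤ y ^ θ₀ := Real.rpow_le_rpow_of_exponent_le hy1 (by linarith)
    have hq' : y ^ (3 / 4 : ℝ) ≤ y ^ θ₀ := Real.rpow_le_rpow_of_exponent_le hy1 hθ₀b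
    have hqa : y ^ α ≤ y ^ θ₀ := Real.rpow_le_rpow_of_exponent_le hy1 hθ₀a
    have hsqrt : Real.sqrt y * y ^ (1 / 4 : ℝ) = y ^ (3 / 4 : ℝ) := by
      rw [Real.sqrt_eq_rpow, ← Real.rpow_add hy0]; norm_num
    -- `log (y + 2) ≤ log 2 + log y`
    have hl2 : Real.log (y + 2) ≤ Real.log 2 + Real.log y := by
      rw [← Real.log_mul (by norm_num) hy0.ne']
      exact Real.log_le_log (by linarith) (by linarith)
    have hyq : 0 ≤ y ^ (1 / 4 : ℝ) := Real.rpow_nonneg hy0.le _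
    have hsq0 : 0 ≤ Real.sqrt y := Real.sqrt_nonneg y
    -- bound the small terms
    have e1 : 2 * Real.sqrt y * Real.log y ≤ 8 * y ^ θ₀ := by
      calc 2 * Real.sqrt y * Real.log y ≤ 2 * Real.sqrt y * (4 * y ^ (1 / 4 : ℝ)) :=
            mul_le_mul_of_nonneg_left hl4 (by positivity)
        _ = 8 * (Real.sqrt y * y ^ (1 / 4 : ℝ)) := by ring
        _ = 8 * y ^ (3 / 4 : ℝ) := by rw [hsqrt]
        _ ≤ 8 * y ^ θ₀ := by linarith
    have e2 : (K : ℝ) * Real.log y ≤ 4 * K * y ^ θ₀ := by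
      have hK0 : (0 : ℝ) ≤ K := Nat.cast_nonneg K
      calc (K : ℝ) * Real.log y ≤ K * (4 * y ^ (1 / 4 : ℝ)) := mul_le_mul_of_nonneg_left hl4 hK0
        _ ≤ K * (4 * y ^ θ₀) := by gcongr
        _ = 4 * K * y ^ θ₀ := by ring
    have e3 : C * y ^ α ≤ |C| * y ^ θ₀ :=
      (mul_le_mul_of_nonneg_right (le_abs_self C) (Real.rpow_nonneg hy0.le _)).trans
        (mul_le_mul_of_nonneg_left hqa (abs_nonneg C))
    have e4 : Real.log (y + 2) ≤ Real.log 2 + 4 * y ^ θ₀ := by linarith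
    have : (y - 1) * Real.log 2 - Real.log (y + 2) - 2 * Real.sqrt y * Real.log y ≤
        K * Real.log y + C * y ^ α := h2.trans h1
    rw [hM]
    nlinarith [this, e1, e2, e3, e4, Real.rpow_nonneg hy0.le θ₀]
  -- but `2 log 2 / y + M y^{θ₀ − 1} → 0 < log 2`
  have hlog2 : 0 < Real.log 2 := Real.log_pos (by norm_num)
  have ht : Tendsto (fun y : ℝ ↦ 2 * Real.log 2 * y ^ (-(1 : ℝ)) + M * y ^ (θ₀ - 1)) atTop (𝓝 0) := by
    have h1 := (tendsto_rpow_neg_atTop (y := 1) one_pos).const_mul (2 * Real.log 2)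
    have h2 := (tendsto_rpow_neg_atTop (y := 1 - θ₀) (by linarith)).const_mul M
    rw [mul_zero] at h1 h2
    have h3 := h1.add h2
    rw [add_zero] at h3
    refine h3.congr fun y ↦ ?_
    rw [neg_sub]
  obtain ⟨Y, hY⟩ := ((ht.eventually (gt_mem_nhds hlog2))).exists_forall_of_atTop
  set y : ℝ := max (max x₀ 2) Y with hy
  have hyge : max x₀ 2 ≤ y := le_max_left _ _
  have hy0 : 0 < y := lt_of_lt_of_le (by norm_num) (le_trans (le_max_right _ _) hyge)
  have h1 := hmain y hyge
  have h2 := hY y (le_max_right _ _)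
  -- divide `h1` by `y`
  have h3 : Real.log 2 ≤ 2 * Real.log 2 * y ^ (-(1 : ℝ)) + M * y ^ (θ₀ - 1) := by
    rw [Real.rpow_neg hy0.le, Real.rpow_one, Real.rpow_sub hy0, Real.rpow_one]
    rw [show 2 * Real.log 2 * y⁻¹ + M * (y ^ θ₀ / y) = (2 * Real.log 2 + M * y ^ θ₀) / y by field_simp]
    rw [le_div_iff₀ hy0]
    linarith
  linarith

/-! ### The primes of `𝒫_{α,β}`: `α`-well-behaved, and not better -/

/-- `ψ_𝒮(x) ≤ K x^α` on `[1, ∞)` when `π_𝒮(x) ≪ x^α/log x` and `α > 1/2`. [cite: BrouckeDebruyneRevesz2023, §5 p. 16] -/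
theorem psiOn_delIdx_le_rpow {S : Set ℕ} (hS : ∀ p ∈ S, p.Prime) {α C x₀ : ℝ} (hα : 1 / 2 < α)
    (hπ : ∀ x : ℝ, x₀ ≤ x → (primeCountIn S x : ℝ) ≤ C * (x ^ α / Real.log x)) :
    ∃ K : ℝ, ∀ x : ℝ, 1 ≤ x → ratPrimes.psiOn (delIdx S) x ≤ K * x ^ α := by
  set δ : ℝ := (α - 1 / 2) / 2 with hδ
  have hδ0 : 0 < δ := by rw [hδ]; linarith
  set X₁ : ℝ := max x₀ 2 with hX₁
  have hX₁2 : 2 ≤ X₁ := le_max_right _ _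
  have hlog2 : 0 < Real.log 2 := Real.log_pos (by norm_num)
  refine ⟨|C| + 4 / (Real.log 2 * δ ^ 2) + (Real.log 4 + 4) * X₁, fun x hx ↦ ?_⟩
  have hx0 : 0 < x := by linarith
  have hxα : 1 ≤ x ^ α := Real.one_le_rpow hx (by linarith)
  have hxα0 : 0 ≤ x ^ α := by linarith
  have hc1 : 0 ≤ |C| * x ^ α := mul_nonneg (abs_nonneg C) hxα0
  have hc2 : 0 ≤ 4 / (Real.log 2 * δ ^ 2) * x ^ α := mul_nonneg (by positivity) hxα0
  have hc3 : 0 ≤ (Real.log 4 + 4) * X₁ * x ^ α := by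
    have : 0 ≤ Real.log 4 + 4 := by positivity
    positivity
  rcases lt_or_ge x X₁ with hlt | hge
  · -- small `x`: `ψ_𝒮 ≤ ψ ≤ (log 4 + 4) x ≤ (log 4 + 4) X₁ x^α`
    have h1 : ratPrimes.psiOn (delIdx S) x ≤ ψ x := by
      rw [← chebyshevPsi_ratPrimes]; exact ratPrimes.psiOn_le_chebyshevPsi _ x
    have h2 : ψ x ≤ (Real.log 4 + 4) * x := Chebyshev.psi_le_const_mul_self hx0.le
    have h3 : (Real.log 4 + 4) * x ≤ (Real.log 4 + 4) * X₁ * x ^ α := by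
      have hl : 0 ≤ Real.log 4 + 4 := by positivity
      calc (Real.log 4 + 4) * x ≤ (Real.log 4 + 4) * X₁ := mul_le_mul_of_nonneg_left hlt.le hl
        _ = (Real.log 4 + 4) * X₁ * 1 := (mul_one _).symm
        _ ≤ (Real.log 4 + 4) * X₁ * x ^ α := mul_le_mul_of_nonneg_left hxα (by positivity)
    nlinarith
  · -- large `x`
    have hx2 : 2 ≤ x := le_trans hX₁2 hge
    have hlogx : Real.log 2 ≤ Real.log x := Real.log_le_log (by norm_num) hx2
    have hlog0 : 0 < Real.log x := lt_of_lt_of_le hlog2 hlogx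
    have h1 := psiOn_delIdx_le hS hx
    have hπx := hπ x (le_trans (le_max_left _ _) hge)
    -- `π_𝒮 log x ≤ |C| x^α`
    have h2 : (primeCountIn S x : ℝ) * Real.log x ≤ |C| * x ^ α := by
      calc (primeCountIn S x : ℝ) * Real.log x ≤ C * (x ^ α / Real.log x) * Real.log x :=
            mul_le_mul_of_nonneg_right hπx hlog0.le
        _ = C * x ^ α := by field_simp
        _ ≤ |C| * x ^ α := mul_le_mul_of_nonneg_right (le_abs_self C) hxα0
    -- `(√x + 1) expBound(x) log x ≤ (4/log 2) √x log² x ≤ (4/(log 2 δ²)) x^α`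
    have hE : (ratPrimes.expBound x : ℝ) ≤ 2 * (Real.log x / Real.log 2) := by
      unfold BeurlingPrimes.expBound
      rw [ratPrimes_prime]
      have hq0 : (ratPrime 0 : ℝ) = 2 := by
        norm_cast; exact Nat.nth_prime_zero_eq_two
      rw [hq0]
      push_cast
      have hfl : (⌊Real.log x / Real.log 2⌋₊ : ℝ) ≤ Real.log x / Real.log 2 := Nat.floor_le (by positivity)
      have h1le : (1 : ℝ) ≤ Real.log x / Real.log 2 := by rwa [le_div_iff₀ hlog2, one_mul]
      linarith
    have hsqrt1 : Real.sqrt x + 1 ≤ 2 * Real.sqrt x := by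
      have : 1 ≤ Real.sqrt x := Real.one_le_sqrt.mpr hx
      linarith
    have hlogle : Real.log x ≤ x ^ δ / δ := Real.log_le_rpow_div hx0.le hδ0
    have hlog2le : Real.log x ^ 2 ≤ x ^ (α - 1 / 2) / δ ^ 2 := by
      have hl0 : 0 ≤ Real.log x := hlog0.le
      calc Real.log x ^ 2 ≤ (x ^ δ / δ) ^ 2 := pow_le_pow_left₀ hl0 hlogle 2
        _ = x ^ (α - 1 / 2) / δ ^ 2 := by
            rw [div_pow, ← Real.rpow_natCast, ← Real.rpow_mul hx0.le]
            congr 2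
            rw [hδ]; push_cast; ring
    have hsx : Real.sqrt x * x ^ (α - 1 / 2) = x ^ α := by
      rw [Real.sqrt_eq_rpow, ← Real.rpow_add hx0]; congr 1; ring
    have h3 : (Real.sqrt x + 1) * (ratPrimes.expBound x) * Real.log x ≤ 4 / (Real.log 2 * δ ^ 2) * x ^ α := by
      have hsq0 : 0 ≤ Real.sqrt x := Real.sqrt_nonneg x
      calc (Real.sqrt x + 1) * (ratPrimes.expBound x) * Real.log x
          ≤ (2 * Real.sqrt x) * (2 * (Real.log x / Real.log 2)) * Real.log x := by
            gcongr
        _ = 4 / Real.log 2 * (Real.sqrt x * Real.log x ^ 2) := by field_simp; ring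
        _ ≤ 4 / Real.log 2 * (Real.sqrt x * (x ^ (α - 1 / 2) / δ ^ 2)) := by gcongr
        _ = 4 / (Real.log 2 * δ ^ 2) * (Real.sqrt x * x ^ (α - 1 / 2)) := by field_simp
        _ = 4 / (Real.log 2 * δ ^ 2) * x ^ α := by rw [hsx]
    nlinarith

/-- **The primes of `𝒫_{α,β}` are `α`-well-behaved** under RH: `|ψ_{𝒫_{α,β}}(x) − x| ≤ K x^α` on
`[1, ∞)` ("RH and the asymptotic `π_𝒮(x) = F(x) + O(1) ∼ Li(x^α)` immediately imply that `𝒫_{α,β}` is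
an `α`-system for the primes"). [cite: BrouckeDebruyneRevesz2023, §5 p. 16] -/
theorem delSystem_primeErrorLE (hRH : RiemannHypothesis) {S : Set ℕ} (hS : ∀ p ∈ S, p.Prime)
    (hT : (keptIdx S).Infinite) {s : ℝ} (hs0 : 0 < s) (hs2 : 2 < s) {α C x₀ : ℝ} (hα : 1 / 2 < α)
    (hπ : ∀ x : ℝ, x₀ ≤ x → (primeCountIn S x : ℝ) ≤ C * (x ^ α / Real.log x)) :
    (delSystem S hT s hs0).PrimeErrorLE α := by
  have hε₀ : 0 < α - 1 / 2 := by linarith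
  obtain ⟨C₀, hC₀⟩ := ratPrimes_primeErrorLE_of_riemannHypothesis hRH hε₀
  obtain ⟨K, hK⟩ := psiOn_delIdx_le_rpow hS hα hπ
  refine ⟨C₀ + K + s * (Real.log 4 + 4), fun x hx ↦ ?_⟩
  have hx0 : 0 < x := by linarith
  have h1 := hC₀ x hx
  rw [chebyshevPsi_ratPrimes, show 1 / 2 + (α - 1 / 2) = α by ring] at h1
  have h2 := hK x hx
  rw [chebyshevPsi_delSystem hT hs0 hx0.le]
  have hxs0 : 0 ≤ x ^ s⁻¹ := Real.rpow_nonneg hx0.le _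
  have h3 : ψ (x ^ s⁻¹) ≤ (Real.log 4 + 4) * x ^ s⁻¹ := Chebyshev.psi_le_const_mul_self hxs0
  have h4 : x ^ s⁻¹ ≤ x ^ α := by
    refine Real.rpow_le_rpow_of_exponent_le hx ?_
    have : s⁻¹ < 1 / 2 := by rw [inv_lt_comm₀ hs0 (by norm_num)]; norm_num; linarith
    linarith
  have h5 : 0 ≤ ψ (x ^ s⁻¹) := Chebyshev.psi_nonneg _
  have h6 : 0 ≤ ratPrimes.psiOn (delIdx S) x := ratPrimes.psiOn_nonneg _ x
  have hl4 : 0 ≤ Real.log 4 + 4 := by positivity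
  have hp1 : 0 ≤ s * (Real.log 4 + 4) * x ^ α := by positivity
  have hp2 : 0 ≤ s * ψ (x ^ s⁻¹) := mul_nonneg hs0.le h5
  have hp3 : s * ψ (x ^ s⁻¹) ≤ s * (Real.log 4 + 4) * x ^ α := by
    calc s * ψ (x ^ s⁻¹) ≤ s * ((Real.log 4 + 4) * x ^ α) :=
          mul_le_mul_of_nonneg_left (h3.trans (mul_le_mul_of_nonneg_left h4 hl4)) hs0.le
      _ = s * (Real.log 4 + 4) * x ^ α := by ring
  have hlo := (abs_le.mp h1).1
  have hhi := (abs_le.mp h1).2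
  rw [abs_le]
  constructor
  · linarith
  · linarith

/-- **… and not better**: under RH, `|ψ_{𝒫_{α,β}}(x) − x| ≤ K x^γ` on `[1, ∞)` fails for every `γ < α`,
since `ψ_𝒮(x) ≥ (c/2) x^α − C x^{α/2}` for large `x`. [cite: BrouckeDebruyneRevesz2023, §5 p. 16] -/
theorem not_delSystem_primeErrorLE (hRH : RiemannHypothesis) {S : Set ℕ} (hS : ∀ p ∈ S, p.Prime)
    (hT : (keptIdx S).Infinite) {s : ℝ} (hs0 : 0 < s) (hs2 : 2 < s) {α c C x₀ : ℝ} (hα : 1 / 2 < α)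
    (hc : 0 < c) (hπ : ∀ x : ℝ, x₀ ≤ x →
      c * (x ^ α / Real.log x) ≤ primeCountIn S x ∧ (primeCountIn S x : ℝ) ≤ C * (x ^ α / Real.log x))
    {γ : ℝ} (hγ : γ < α) : ¬ (delSystem S hT s hs0).PrimeErrorLE γ := by
  rintro ⟨K, hK⟩
  -- upper bound `ψ_𝒮(x) ≤ K₂ x^θ` with `θ < α`
  set α₀ : ℝ := 1 / 2 + (α - 1 / 2) / 2 with hα₀
  have hα₀lt : α₀ < α := by rw [hα₀]; linarith
  obtain ⟨C₀, hC₀⟩ := ratPrimes_primeErrorLE_of_riemannHypothesis hRH (by linarith : 0 < (α - 1 / 2) / 2)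
  have hsi : s⁻¹ < 1 / 2 := by rw [inv_lt_comm₀ hs0 (by norm_num)]; norm_num; linarith
  set θ' : ℝ := max (max α₀ γ) s⁻¹ with hθ'
  have hθ'lt : θ' < α := max_lt (max_lt hα₀lt hγ) (by linarith)
  set K₂ : ℝ := |C₀| + |K| + s * (Real.log 4 + 4) with hK₂
  have hup : ∀ x : ℝ, 1 ≤ x → ratPrimes.psiOn (delIdx S) x ≤ K₂ * x ^ θ' := by
    intro x hx
    have hx0 : 0 < x := by linarith
    have h1 := hC₀ x hx
    rw [chebyshevPsi_ratPrimes] at h1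
    have h2 := hK x hx
    rw [chebyshevPsi_delSystem hT hs0 hx0.le] at h2
    have hxs0 : 0 ≤ x ^ s⁻¹ := Real.rpow_nonneg hx0.le _
    have h3 : ψ (x ^ s⁻¹) ≤ (Real.log 4 + 4) * x ^ s⁻¹ := Chebyshev.psi_le_const_mul_self hxs0
    have hxθ : 0 ≤ x ^ θ' := Real.rpow_nonneg hx0.le _
    have e1 : x ^ (1 / 2 + (α - 1 / 2) / 2) ≤ x ^ θ' :=
      Real.rpow_le_rpow_of_exponent_le hx ((le_max_left _ _).trans (le_max_left _ _))
    have e2 : x ^ γ ≤ x ^ θ' := Real.rpow_le_rpow_of_exponent_le hx ((le_max_right _ _).trans (le_max_left _ _))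
    have e3 : x ^ s⁻¹ ≤ x ^ θ' := Real.rpow_le_rpow_of_exponent_le hx (le_max_right _ _)
    have hl4 : 0 ≤ Real.log 4 + 4 := by positivity
    have b1 : ψ x - x ≤ |C₀| * x ^ θ' :=
      ((abs_le.mp h1).2.trans (mul_le_mul_of_nonneg_right (le_abs_self _) (Real.rpow_nonneg hx0.le _))).trans
        (mul_le_mul_of_nonneg_left e1 (abs_nonneg _))
    have b2 : -((delSystem S hT s hs0).chebyshevPsi x - x) ≤ |K| * x ^ θ' := by
      rw [chebyshevPsi_delSystem hT hs0 hx0.le]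
      have := (abs_le.mp h2).1
      have hKx : K * x ^ γ ≤ |K| * x ^ θ' :=
        (mul_le_mul_of_nonneg_right (le_abs_self K) (Real.rpow_nonneg hx0.le _)).trans
          (mul_le_mul_of_nonneg_left e2 (abs_nonneg K))
      linarith
    have b3 : s * ψ (x ^ s⁻¹) ≤ s * (Real.log 4 + 4) * x ^ θ' := by
      calc s * ψ (x ^ s⁻¹) ≤ s * ((Real.log 4 + 4) * x ^ s⁻¹) := mul_le_mul_of_nonneg_left h3 hs0.le
        _ ≤ s * ((Real.log 4 + 4) * x ^ θ') := by gcongr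
        _ = s * (Real.log 4 + 4) * x ^ θ' := by ring
    rw [chebyshevPsi_delSystem hT hs0 hx0.le] at b2
    rw [hK₂]
    nlinarith [b1, b2, b3]
  -- lower bound `ψ_𝒮(x) ≥ (c/2) x^α − C x^{α/2}` for `x ≥ X₂`
  set X₂ : ℝ := max (max x₀ (x₀ ^ 2)) 4 with hX₂
  have hlow : ∀ x : ℝ, X₂ ≤ x → c / 2 * x ^ α - C * x ^ (α / 2) ≤ ratPrimes.psiOn (delIdx S) x := by
    intro x hx
    have hx4 : 4 ≤ x := le_trans (le_max_right _ _) hx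
    have hx1 : 1 ≤ x := by linarith
    have hx0 : 0 < x := by linarith
    have hlog0 : 0 < Real.log x := Real.log_pos (by linarith)
    have hxx₀ : x₀ ≤ x := le_trans ((le_max_left _ _).trans (le_max_left _ _)) hx
    have hsx₀ : x₀ ≤ Real.sqrt x := by
      rcases le_or_gt x₀ 0 with h0 | h0
      · exact le_trans h0 (Real.sqrt_nonneg x)
      · refine Real.le_sqrt_of_sq_le ?_
        exact le_trans ((le_max_right _ _).trans (le_max_left _ _)) hx
    have h1 := le_psiOn_delIdx hS hx1
    have hπx := (hπ x hxx₀).1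
    have hπs := (hπ (Real.sqrt x) hsx₀).2
    have hsq : Real.sqrt x ^ α = x ^ (α / 2) := by
      rw [Real.sqrt_eq_rpow, ← Real.rpow_mul hx0.le]; congr 1; ring
    rw [hsq, Real.log_sqrt hx0.le] at hπs
    -- `(log x / 2) (π_𝒮 x − π_𝒮 √x) ≥ (log x/2)(c x^α/log x − C x^{α/2}/(log x/2))`
    have h2 : Real.log x / 2 * ((primeCountIn S x : ℝ) - primeCountIn S (Real.sqrt x)) ≥
        Real.log x / 2 * (c * (x ^ α / Real.log x) - C * (x ^ (α / 2) / (Real.log x / 2))) :=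
      mul_le_mul_of_nonneg_left (by linarith) (by positivity)
    have h3 : Real.log x / 2 * (c * (x ^ α / Real.log x) - C * (x ^ (α / 2) / (Real.log x / 2))) =
        c / 2 * x ^ α - C * x ^ (α / 2) := by field_simp
    linarith
  -- contradiction: `c/2 ≤ C x^{-α/2} + K₂ x^{θ'-α} → 0`
  have ht : Tendsto (fun x : ℝ ↦ C * x ^ (-(α / 2)) + K₂ * x ^ (θ' - α)) atTop (𝓝 0) := by
    have h1 := (tendsto_rpow_neg_atTop (y := α / 2) (by linarith)).const_mul C
    have h2 := (tendsto_rpow_neg_atTop (y := α - θ') (by linarith)).const_mul K₂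
    rw [mul_zero] at h1 h2
    have h3 := h1.add h2
    rw [add_zero] at h3
    refine h3.congr fun x ↦ ?_
    rw [neg_sub]
  obtain ⟨Y, hY⟩ := (ht.eventually (gt_mem_nhds (by linarith : (0 : ℝ) < c / 2))).exists_forall_of_atTop
  set x : ℝ := max X₂ Y with hxdef
  have hx4 : 4 ≤ x := le_trans (le_max_right _ _) (le_max_left _ _)
  have hx1 : 1 ≤ x := by linarith
  have hx0 : 0 < x := by linarith
  have h1 := hlow x (le_max_left _ _)
  have h2 := hup x hx1
  have h3 := hY x (le_max_right _ _)
  have hxα : 0 < x ^ α := Real.rpow_pos_of_pos hx0 _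
  -- `c/2 x^α − C x^{α/2} ≤ K₂ x^θ'`; divide by `x^α`
  have h4 : c / 2 * x ^ α - C * x ^ (α / 2) ≤ K₂ * x ^ θ' := h1.trans h2
  have e1 : C * x ^ (α / 2) = C * x ^ (-(α / 2)) * x ^ α := by
    rw [mul_assoc, ← Real.rpow_add hx0]; congr 2; ring
  have e2 : K₂ * x ^ θ' = K₂ * x ^ (θ' - α) * x ^ α := by
    rw [mul_assoc, ← Real.rpow_add hx0]; congr 2; ring
  rw [e1, e2] at h4
  have h5 : c / 2 ≤ C * x ^ (-(α / 2)) + K₂ * x ^ (θ' - α) := by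
    have := div_le_div_of_nonneg_right h4 hxα.le
    rw [show (c / 2 * x ^ α - C * x ^ (-(α / 2)) * x ^ α) / x ^ α = c / 2 - C * x ^ (-(α / 2)) by
      field_simp, mul_div_assoc, div_self hxα.ne', mul_one] at this
    linarith
  linarith

/-! ### The integers of `𝒫_{α,β}`: `β`-well-behaved, and not better -/

/-- **The integers of `𝒫_{α,β}` are `β`-well-behaved**: if `|N'(y) − ay| ≤ C y^γ` on `[1, ∞)` with
`1/s ≤ γ` and `sγ > 1`, then `|N_{𝒫_{α,β}}(x) − aζ(s) x| ≤ K x^γ` on `[1, ∞)` (direct summation: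
`N(x) = ∑_{m ≤ x^{1/s}} N'(x/m^s) = ∑_{m ≤ x^{1/s}} (a x m^{−s} + O((x/m^s)^γ))`; BDR, "by even simpler
means", case `β = 2α/(α+2)`). [cite: BrouckeDebruyneRevesz2023, §5 p. 17] -/
theorem delSystem_intErrorLE {S : Set ℕ} (hT : (keptIdx S).Infinite) {s : ℝ} (hs0 : 0 < s) (hs1 : 1 < s)
    {a γ C : ℝ} (ha : 0 ≤ a) (hγ : s⁻¹ ≤ γ) (hsγ : 1 < s * γ)
    (hN : ∀ y : ℝ, 1 ≤ y →
      |(Nat.card {n : ℕ // (n ≠ 0 ∧ IsFree S n) ∧ (n : ℝ) ≤ y} : ℝ) - a * y| ≤ C * y ^ γ) :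
    (delSystem S hT s hs0).IntErrorLE (a * zetaR s) γ := by
  have hs : 1 ≤ s := hs1.le
  have hγ0 : 0 < γ := lt_of_lt_of_le (inv_pos.mpr hs0) hγ
  have hC : 0 ≤ C := by
    have := hN 1 le_rfl
    simp only [Real.one_rpow, mul_one] at this
    exact le_trans (abs_nonneg _) this
  -- the constant
  set K : ℝ := C * zetaR (s * γ) + a * (2 ^ (s - 1) / (s - 1)) with hK
  refine ⟨K, fun x hx ↦ ?_⟩
  have hx0 : 0 < x := by linarith
  -- `N(x) = ∑_{m ≤ M} posInd m · N'(x/m^s)`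
  rw [intCount_delSystem hT hs0, card_eq_hypConv S hs x, hypConv_freeInd_eq_sum S hs hx]
  set M : ℕ := ⌊x ^ s⁻¹⌋₊ with hM
  have hxβ : 1 ≤ x ^ s⁻¹ := Real.one_le_rpow hx (inv_nonneg.mpr hs0.le)
  have hM1 : 1 ≤ M := Nat.le_floor (by simpa using hxβ)
  have hMle : (M : ℝ) ≤ x ^ s⁻¹ := Nat.floor_le (by linarith)
  have hMge : x ^ s⁻¹ / 2 ≤ M := by
    have h1 : x ^ s⁻¹ - 1 < M := by rw [hM]; exact Nat.sub_one_lt_floor _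
    have h2 : (1 : ℝ) ≤ M := by exact_mod_cast hM1
    by_cases h : x ^ s⁻¹ ≤ 2
    · linarith
    · push Not at h; linarith
  have hMpos : (0 : ℝ) < M := by exact_mod_cast hM1
  -- `ζ(s) = ∑_{m ≤ M} m^{-s} + tail`
  have hz := zetaR_eq_sum_add_tsum hs1 M
  rw [Nat.range_succ_eq_Icc_zero] at hz
  have htail := tsum_tail_le hs1 hM1
  have htail0 : 0 ≤ ∑' n : ℕ, ((n + (M + 1) : ℕ) : ℝ) ^ (-s) :=
    tsum_nonneg fun n ↦ Real.rpow_nonneg (Nat.cast_nonneg _) _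
  -- termwise: `|posInd m N'(x/m^s) − a x m^{-s}| ≤ C x^γ m^{-sγ}`
  have hterm : ∀ m ∈ Finset.Icc 0 M,
      |posInd m * partialSum (freeInd S) (x / (m : ℝ) ^ s) - a * x * (m : ℝ) ^ (-s)| ≤
        C * x ^ γ * (m : ℝ) ^ (-(s * γ)) := by
    intro m hm
    rcases Nat.eq_zero_or_pos m with hm0 | hmpos
    · subst hm0
      simp [Real.zero_rpow (neg_ne_zero.mpr hs0.ne'), Real.zero_rpow (neg_ne_zero.mpr (by positivity : s * γ ≠ 0))]
    · have hmr : (0 : ℝ) < m := by exact_mod_cast hmpos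
      have hms : (0 : ℝ) < (m : ℝ) ^ s := Real.rpow_pos_of_pos hmr s
      have hmM : (m : ℝ) ≤ x ^ s⁻¹ := le_trans (by exact_mod_cast (Finset.mem_Icc.mp hm).2) hMle
      have hmsx : (m : ℝ) ^ s ≤ x := by
        have := Real.rpow_le_rpow hmr.le hmM hs0.le
        rwa [← Real.rpow_mul hx0.le, inv_mul_cancel₀ hs0.ne', Real.rpow_one] at this
      have hu : 1 ≤ x / (m : ℝ) ^ s := by rwa [le_div_iff₀ hms, one_mul]
      have h1 := hN (x / (m : ℝ) ^ s) hu
      rw [← partialSum_freeInd_eq_card S (by positivity : 0 ≤ x / (m : ℝ) ^ s)] at h1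
      rw [posInd_of_ne_zero hmpos.ne', one_mul]
      have e1 : a * x * (m : ℝ) ^ (-s) = a * (x / (m : ℝ) ^ s) := by
        rw [Real.rpow_neg hmr.le, div_eq_mul_inv]; ring
      have e2 : (x / (m : ℝ) ^ s) ^ γ = x ^ γ * (m : ℝ) ^ (-(s * γ)) := div_rpow_pow hx0.le hmr.le γ
      rw [e1]
      calc |partialSum (freeInd S) (x / (m : ℝ) ^ s) - a * (x / (m : ℝ) ^ s)| ≤ C * (x / (m : ℝ) ^ s) ^ γ := h1
        _ = C * x ^ γ * (m : ℝ) ^ (-(s * γ)) := by rw [e2]; ring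
  -- sum of the termwise bounds
  have hsumγ : ∑ m ∈ Finset.Icc 0 M, (m : ℝ) ^ (-(s * γ)) ≤ zetaR (s * γ) := by
    unfold zetaR
    exact (summable_rpow_neg hsγ).sum_le_tsum (Finset.Icc 0 M) fun m _ ↦ Real.rpow_nonneg (Nat.cast_nonneg m) _
  have hA : |(∑ m ∈ Finset.Icc 0 M, posInd m * partialSum (freeInd S) (x / (m : ℝ) ^ s)) -
      a * x * ∑ m ∈ Finset.Icc 0 M, (m : ℝ) ^ (-s)| ≤ C * x ^ γ * zetaR (s * γ) := by
    rw [Finset.mul_sum, ← Finset.sum_sub_distrib]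
    refine (Finset.abs_sum_le_sum_abs _ _).trans ?_
    refine (Finset.sum_le_sum hterm).trans ?_
    rw [← Finset.mul_sum]
    exact mul_le_mul_of_nonneg_left hsumγ (mul_nonneg hC (Real.rpow_nonneg hx0.le _))
  -- the tail term `a x tail ≤ a 2^{s-1}/(s-1) x^{1/s} ≤ … x^γ`
  have hpow : (M : ℝ) ^ (1 - s) ≤ (x ^ s⁻¹ / 2) ^ (1 - s) :=
    Real.rpow_le_rpow_of_nonpos (by positivity) hMge (by linarith)
  have hsplit : (x ^ s⁻¹ / 2) ^ (1 - s) = 2 ^ (s - 1) * (x ^ s⁻¹ * x⁻¹) := by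
    rw [Real.div_rpow (by positivity) (by norm_num), ← Real.rpow_mul hx0.le]
    rw [show s⁻¹ * (1 - s) = s⁻¹ + (-1) by field_simp; ring, Real.rpow_add hx0, Real.rpow_neg_one,
      show (1 - s : ℝ) = -(s - 1) by ring, Real.rpow_neg (by norm_num), div_eq_mul_inv, inv_inv, mul_comm]
  have hB : a * x * ∑' n : ℕ, ((n + (M + 1) : ℕ) : ℝ) ^ (-s) ≤ a * (2 ^ (s - 1) / (s - 1)) * x ^ γ := by
    have h1 : ∑' n : ℕ, ((n + (M + 1) : ℕ) : ℝ) ^ (-s) ≤ 2 ^ (s - 1) * (x ^ s⁻¹ * x⁻¹) / (s - 1) :=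
      le_trans htail (div_le_div_of_nonneg_right (hsplit ▸ hpow) (by linarith))
    have h2 := mul_le_mul_of_nonneg_left h1 (mul_nonneg ha hx0.le)
    have hxγ : x ^ s⁻¹ ≤ x ^ γ := Real.rpow_le_rpow_of_exponent_le hx hγ
    calc a * x * ∑' n : ℕ, ((n + (M + 1) : ℕ) : ℝ) ^ (-s) ≤ a * x * (2 ^ (s - 1) * (x ^ s⁻¹ * x⁻¹) / (s - 1)) := h2
      _ = a * (2 ^ (s - 1) / (s - 1)) * x ^ s⁻¹ := by field_simp
      _ ≤ a * (2 ^ (s - 1) / (s - 1)) * x ^ γ :=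
          mul_le_mul_of_nonneg_left hxγ (mul_nonneg ha (div_nonneg (Real.rpow_nonneg (by norm_num) _) (by linarith)))
  -- assemble
  have hdecomp : (∑ m ∈ Finset.Icc 0 M, posInd m * partialSum (freeInd S) (x / (m : ℝ) ^ s)) - a * zetaR s * x =
      ((∑ m ∈ Finset.Icc 0 M, posInd m * partialSum (freeInd S) (x / (m : ℝ) ^ s)) -
        a * x * ∑ m ∈ Finset.Icc 0 M, (m : ℝ) ^ (-s)) - a * x * ∑' n : ℕ, ((n + (M + 1) : ℕ) : ℝ) ^ (-s) := by
    rw [hz]; ring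
  rw [hdecomp]
  refine (abs_sub _ _).trans ?_
  rw [abs_of_nonneg (mul_nonneg (mul_nonneg ha hx0.le) htail0)]
  calc |(∑ m ∈ Finset.Icc 0 M, posInd m * partialSum (freeInd S) (x / (m : ℝ) ^ s)) -
        a * x * ∑ m ∈ Finset.Icc 0 M, (m : ℝ) ^ (-s)| + a * x * ∑' n : ℕ, ((n + (M + 1) : ℕ) : ℝ) ^ (-s)
      ≤ C * x ^ γ * zetaR (s * γ) + a * (2 ^ (s - 1) / (s - 1)) * x ^ γ := add_le_add hA hB
    _ = K * x ^ γ := by rw [hK]; ring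

/-- **… and not better** (`β > 2α/(α+2)`): if `|N'(y) − ay| ≤ C y^γ` on `[1, ∞)` with `0 ≤ γ < β`, and
Lemma 5.1's constant `I(β) = lim_R (∑_{n ≤ R, n ∈ 𝒩} n^{−β} − aR^{1−β}/(1−β))` is non-zero, then
`N_{𝒫_{α,β}}(x) = aζ(1/β)x + I(β)x^β + O(x^θ)` with `θ < β` (hyperbola lemma with `ℒ = ℕ^{1/β}`,
`h ≡ 1`, `L(u) = ⌊u^β⌋ = u^β + O(1)`), so `|N_{𝒫_{α,β}}(x) − aζ(1/β)x| ≤ K x^{β−ε}` fails for every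
`ε > 0`. [cite: BrouckeDebruyneRevesz2023, §5 pp. 16–17] -/
theorem not_delSystem_intErrorLE {S : Set ℕ} (hT : (keptIdx S).Infinite) {β : ℝ} (hβ0 : 0 < β)
    (hβ1 : β < 1) {a γ C I : ℝ} (hγ0 : 0 ≤ γ) (hγβ : γ < β)
    (hN : ∀ y : ℝ, 1 ≤ y →
      |(Nat.card {n : ℕ // (n ≠ 0 ∧ IsFree S n) ∧ (n : ℝ) ≤ y} : ℝ) - a * y| ≤ C * y ^ γ)
    (hI : I ≠ 0)
    (hlim : Tendsto (fun R : ℕ ↦ ∑ n ∈ Finset.Icc 0 R, freeInd S n * (n : ℝ) ^ (-β)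
      - a / (1 - β) * (R : ℝ) ^ (1 - β)) atTop (𝓝 I))
    {ε : ℝ} (hε : 0 < ε) :
    ¬ (delSystem S hT β⁻¹ (inv_pos.mpr hβ0)).IntErrorLE (a * zetaR β⁻¹) (β - ε) := by
  have hs : 1 ≤ β⁻¹ := (one_le_inv₀ hβ0).mpr hβ1.le
  have hs0 : 0 < β⁻¹ := inv_pos.mpr hβ0
  have hsne : β⁻¹ ≠ 0 := hs0.ne'
  -- hypotheses of the hyperbola lemma
  have hN' : ∀ t : ℝ, 1 ≤ t → |partialSum (freeInd S) t - a * t| ≤ C * t ^ γ := by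
    intro t ht
    rw [partialSum_freeInd_eq_card S (by linarith)]
    exact hN t ht
  have hL' : ∀ u : ℝ, 1 ≤ u → |partialSum posInd (u ^ β⁻¹⁻¹) - 1 * u ^ β| ≤ 1 * u ^ (0 : ℝ) := by
    intro u hu
    rw [inv_inv, partialSum_posInd, Real.rpow_zero, one_mul, one_mul]
    have h0 : 0 ≤ u ^ β := Real.rpow_nonneg (by linarith) _
    rw [abs_le]
    constructor <;> linarith [Nat.floor_le h0, Nat.lt_floor_add_one (u ^ β)]
  obtain ⟨hH, hT', Ch, hCh⟩ := hyperbola_lemma (freeInd S) posInd β⁻¹ (freeInd_zero S) (freeInd_nonneg S)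
    posInd_zero posInd_nonneg hs hγ0 hγβ le_rfl hβ0 hβ1 hN' hL'
  -- `H(1) = ζ(1/β)`
  have hHeq : hypH posInd β⁻¹ = zetaR β⁻¹ := by
    have hf : (fun m : ℕ ↦ posInd m * (m : ℝ) ^ (-β⁻¹)) = fun m : ℕ ↦ (m : ℝ) ^ (-β⁻¹) := by
      funext m
      rcases Nat.eq_zero_or_pos m with hm | hm
      · subst hm; simp [Real.zero_rpow (neg_ne_zero.mpr hsne)]
      · rw [posInd_of_ne_zero hm.ne', one_mul]
    rw [hf] at hH
    unfold zetaR
    exact hH.tsum_eq.symm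
  -- `I(β) = I`
  have hIeq : abelConst (freeInd S) a β = I := tendsto_nhds_unique hT' hlim
  rw [hHeq, hIeq, one_mul] at hCh
  -- the exponent is `< β`
  have hexp : (β - γ * 0) / (1 - γ + β - 0) < β := by
    rw [mul_zero, sub_zero, sub_zero, div_lt_iff₀ (by linarith)]
    nlinarith
  set e : ℝ := (β - γ * 0) / (1 - γ + β - 0) with he
  -- suppose the integers were better
  rintro ⟨K, hK⟩
  have habs : 0 < |I| := abs_pos.mpr hI
  have ht : Tendsto (fun x : ℝ ↦ Ch * x ^ (-(β - e)) + K * x ^ (-ε)) atTop (𝓝 0) := by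
    have h1 := (tendsto_rpow_neg_atTop (y := β - e) (by linarith)).const_mul Ch
    have h2 := (tendsto_rpow_neg_atTop (y := ε) hε).const_mul K
    rw [mul_zero] at h1 h2
    have h3 := h1.add h2
    rwa [add_zero] at h3
  obtain ⟨Y, hY⟩ := (ht.eventually (gt_mem_nhds habs)).exists_forall_of_atTop
  set x : ℝ := max Y 1 with hxdef
  have hx1 : 1 ≤ x := le_max_right _ _
  have hx0 : 0 < x := by linarith
  have h1 := hCh x hx1
  have h2 := hK x hx1
  rw [intCount_delSystem hT hs0, card_eq_hypConv S hs x] at h2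
  have h3 := hY x (le_max_left _ _)
  have hxβ : 0 < x ^ β := Real.rpow_pos_of_pos hx0 _
  -- `|I| x^β ≤ Ch x^e + K x^{β−ε}`
  have h4 : |I| * x ^ β ≤ Ch * x ^ e + K * x ^ (β - ε) := by
    have : |I * x ^ β| ≤ |hypConv (freeInd S) posInd β⁻¹ x - (a * zetaR β⁻¹ * x + I * x ^ β)| +
        |hypConv (freeInd S) posInd β⁻¹ x - a * zetaR β⁻¹ * x| := by
      rw [← abs_neg (hypConv (freeInd S) posInd β⁻¹ x - (a * zetaR β⁻¹ * x + I * x ^ β))]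
      refine (abs_add_le _ _).trans' (le_of_eq ?_)
      congr 1; ring
    rw [abs_mul, abs_of_pos hxβ] at this
    linarith
  have e1 : Ch * x ^ e = Ch * x ^ (-(β - e)) * x ^ β := by
    rw [mul_assoc, ← Real.rpow_add hx0]; congr 2; ring
  have e2 : K * x ^ (β - ε) = K * x ^ (-ε) * x ^ β := by
    rw [mul_assoc, ← Real.rpow_add hx0]; congr 2; ring
  rw [e1, e2] at h4
  have h5 : |I| ≤ Ch * x ^ (-(β - e)) + K * x ^ (-ε) := by
    have := div_le_div_of_nonneg_right h4 hxβ.le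
    rwa [mul_div_assoc, div_self hxβ.ne', mul_one, show (Ch * x ^ (-(β - e)) * x ^ β + K * x ^ (-ε) * x ^ β) / x ^ β
      = Ch * x ^ (-(β - e)) + K * x ^ (-ε) by field_simp] at this
  linarith

/-! ### Theorem 1.3, second assertion, from the analytic input of §5 -/

/-- **`𝒫_{α,β}` is an `[α, β]`-system, given the analytic input of BDR §5.** Assume RH,
`1/2 < α < 1`, `2α/(α+2) ≤ β < 1/2`, and let `S` be a set of rational primes (BDR's `𝒫_𝒮`, pp. 15–16:
selected by the probabilistic procedure of Theorem 1.2 applied to `F(x) = ∫₁ˣ u^{α−1} d(π + E)(u)`)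
with
* (π) `c x^α/log x ≤ π_𝒮(x) ≤ C x^α/log x` for `x ≥ x₀` ("`π_𝒮(x) = F(x) + O(1) ∼ Li(x^α)`", p. 16);
* (N') `|N'(y) − ay| ≤ C_ε y^{2α/(α+2)+ε}` on `[1, ∞)` for every `ε > 0`, some `a > 0`, where
  `N'(y) = #{n ≤ y : p | n ⇒ p ∉ 𝒫_𝒮}` ("`∑_{nl ≤ x, n ∈ ℕ, l ∈ 𝒩_𝒮} μ_𝒮(l) = x/ζ_𝒮(1) +
  O_ε(x^{2α/(α+2)+ε})`", p. 16, `a = 1/ζ_𝒮(1)`);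
* (I) if `β > 2α/(α+2)`: Lemma 5.1's `I(β) = lim_R (∑_{n ≤ R, n ∈ 𝒩} n^{−β} − aR^{1−β}/(1−β))`
  (`= ζ(β)/ζ_𝒮(β)`) is non-zero ("`ζ_𝒮(s)` cannot vanish at `s = 1` or `s = β`", p. 17; "`ζ` does not
  vanish on the positive real line", p. 14);
* (∂) if `β = 2α/(α+2)`: the count `#{(n, m) : n ∈ 𝒩, m ≥ 1, n m^{1/β} ≤ x}` is not `Ax + O(x^{β−ε})`
  for any `A`, `ε > 0` ("that would entail that `ζ_{α,β}(s) = ζ(s)ζ(s/β)/ζ_𝒮(s)` is analytic at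
  `s = β`, which is false", p. 17).
Then `𝒫_{α,β} = ℙ ∪ ℙ^{1/β} ∖ 𝒫_𝒮` (`delSystem S _ β⁻¹`) is an `[α, β]`-system with density
`a ζ(1/β)`. Inputs (π), (N'), (I), (∂) — the random construction, the continuation of `ζ_𝒮` and the
Perron step — are not in the tree; everything downstream of them is proved here.
[cite: BrouckeDebruyneRevesz2023, Theorem 1.3 (§5 pp. 15–17)] -/
theorem isSystem_delSystem_of_estimates (hRH : RiemannHypothesis) {α β : ℝ} (hα : 1 / 2 < α)
    (hα1 : α < 1) (hβlo : 2 * α / (α + 2) ≤ β) (hβ : β < 1 / 2) {S : Set ℕ} (hS : ∀ p ∈ S, p.Prime)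
    {c C x₀ : ℝ} (hc : 0 < c)
    (hπ : ∀ x : ℝ, x₀ ≤ x →
      c * (x ^ α / Real.log x) ≤ primeCountIn S x ∧ (primeCountIn S x : ℝ) ≤ C * (x ^ α / Real.log x))
    {a : ℝ} (ha : 0 < a)
    (hN : ∀ ε : ℝ, 0 < ε → ∃ C' : ℝ, ∀ y : ℝ, 1 ≤ y →
      |(Nat.card {n : ℕ // (n ≠ 0 ∧ IsFree S n) ∧ (n : ℝ) ≤ y} : ℝ) - a * y| ≤ C' * y ^ (2 * α / (α + 2) + ε))
    (hIβ : 2 * α / (α + 2) < β → ∃ I : ℝ, I ≠ 0 ∧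
      Tendsto (fun R : ℕ ↦ ∑ n ∈ Finset.Icc 0 R, freeInd S n * (n : ℝ) ^ (-β)
        - a / (1 - β) * (R : ℝ) ^ (1 - β)) atTop (𝓝 I))
    (hbdry : 2 * α / (α + 2) = β → ∀ A ε : ℝ, 0 < ε → ¬ ∃ C' : ℝ, ∀ x : ℝ, 1 ≤ x →
      |(Nat.card {nm : ℕ × ℕ // (nm.1 ≠ 0 ∧ IsFree S nm.1) ∧ nm.2 ≠ 0 ∧
          (nm.1 : ℝ) * (nm.2 : ℝ) ^ β⁻¹ ≤ x} : ℝ) - A * x| ≤ C' * x ^ (β - ε)) :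
    (delSystem S (keptIdx_infinite hS hα1 fun x hx ↦ (hπ x hx).2) β⁻¹
      (inv_pos.mpr (lt_of_lt_of_le (by positivity) hβlo))).IsSystem α β := by
  have hπup : ∀ x : ℝ, x₀ ≤ x → (primeCountIn S x : ℝ) ≤ C * (x ^ α / Real.log x) := fun x hx ↦ (hπ x hx).2
  set hT : (keptIdx S).Infinite := keptIdx_infinite hS hα1 hπup with hTdef
  have hb0 : 0 < 2 * α / (α + 2) := by positivity
  have hβ0 : 0 < β := lt_of_lt_of_le hb0 hβlo
  have hβ1 : β < 1 := by linarith
  set hs0 : 0 < β⁻¹ := inv_pos.mpr hβ0 with hs0def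
  have hs1 : 1 < β⁻¹ := (one_lt_inv₀ hβ0).mpr hβ1
  have hs2 : 2 < β⁻¹ := by rw [lt_inv_comm₀ (by norm_num) hβ0]; norm_num; linarith
  show (delSystem S hT β⁻¹ hs0).IsSystem α β
  refine ⟨by linarith, hα1, hβ0.le, hβ1, a * zetaR β⁻¹, mul_pos ha (zetaR_pos hs1), ?_, ?_, ?_, ?_⟩
  · -- integers: `β`-well-behaved
    intro ε hε
    have hε' : 0 < β - 2 * α / (α + 2) + ε / 2 := by linarith
    obtain ⟨Cγ, hCγ⟩ := hN (β - 2 * α / (α + 2) + ε / 2) hε'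
    have hγeq : 2 * α / (α + 2) + (β - 2 * α / (α + 2) + ε / 2) = β + ε / 2 := by ring
    rw [hγeq] at hCγ
    have hγ1 : β⁻¹⁻¹ ≤ β + ε / 2 := by rw [inv_inv]; linarith
    have hγ2 : 1 < β⁻¹ * (β + ε / 2) := by
      have e : β⁻¹ * (β + ε / 2) = 1 + β⁻¹ * (ε / 2) := by
        rw [mul_add, inv_mul_cancel₀ hβ0.ne']
      rw [e]
      linarith [mul_pos hs0 (half_pos hε)]
    have h := delSystem_intErrorLE hT hs0 hs1 ha.le hγ1 hγ2 hCγ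
    have hle : β + ε / 2 ≤ β + ε := by linarith
    exact BeurlingPrimes.IntErrorLE.of_le _ h hle
  · -- integers: not better
    intro ε hε
    rcases hβlo.eq_or_lt with hβeq | hβlt
    · -- boundary case `β = 2α/(α+2)`: the cited pole argument
      rintro ⟨K, hK⟩
      refine hbdry hβeq (a * zetaR β⁻¹) ε hε ⟨K, fun x hx ↦ ?_⟩
      have h := hK x hx
      rwa [intCount_delSystem hT hs0] at h
    · -- `β > 2α/(α+2)`: Lemma 5.1 with `I(β) ≠ 0`
      obtain ⟨I, hI, hlim⟩ := hIβ hβlt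
      set γ : ℝ := (2 * α / (α + 2) + β) / 2 with hγ
      have hγlt : γ < β := by rw [hγ]; linarith
      have hγ0 : 0 ≤ γ := by rw [hγ]; positivity
      have hε' : 0 < γ - 2 * α / (α + 2) := by rw [hγ]; linarith
      obtain ⟨Cγ, hCγ⟩ := hN (γ - 2 * α / (α + 2)) hε'
      rw [show 2 * α / (α + 2) + (γ - 2 * α / (α + 2)) = γ by ring] at hCγ
      exact not_delSystem_intErrorLE hT hβ0 hβ1 hγ0 hγlt hCγ hI hlim hε
  · -- primes: `α`-well-behaved
    intro ε hε
    have hle : α ≤ α + ε := by linarith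
    exact BeurlingPrimes.PrimeErrorLE.of_le _ (delSystem_primeErrorLE hRH hS hT hs0 hs2 hα hπup) hle
  · -- primes: not better
    intro ε hε
    have hlt : α - ε < α := by linarith
    exact not_delSystem_primeErrorLE hRH hS hT hs0 hs2 hα hc hπ hlt

/-- **BDR 2023, Theorem 1.3, second assertion, from the analytic input of §5**: if for every
`α ∈ (1/2, 2/3)` there is a set `𝒫_𝒮` of rational primes with the estimates (π), (N'), (I), (∂) of
`isSystem_delSystem_of_estimates` (BDR §5 pp. 15–17), then the named fact
`BrouckeDebruyneRevesz2023_thm13b` holds. The hypothesis is spelled out rather than vendored as a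
further named fact. [cite: BrouckeDebruyneRevesz2023, Theorem 1.3 (§5 pp. 15–17)] -/
theorem BrouckeDebruyneRevesz2023_thm13b_of_estimates
    (h5 : RiemannHypothesis → ∀ α : ℝ, 1 / 2 < α → α < 2 / 3 →
      ∃ S : Set ℕ, (∀ p ∈ S, p.Prime) ∧
        (∃ c C x₀ : ℝ, 0 < c ∧ ∀ x : ℝ, x₀ ≤ x →
          c * (x ^ α / Real.log x) ≤ primeCountIn S x ∧
            (primeCountIn S x : ℝ) ≤ C * (x ^ α / Real.log x)) ∧
        ∃ a : ℝ, 0 < a ∧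
          (∀ ε : ℝ, 0 < ε → ∃ C : ℝ, ∀ y : ℝ, 1 ≤ y →
            |(Nat.card {n : ℕ // (n ≠ 0 ∧ IsFree S n) ∧ (n : ℝ) ≤ y} : ℝ) - a * y|
              ≤ C * y ^ (2 * α / (α + 2) + ε)) ∧
          (∀ β : ℝ, 2 * α / (α + 2) < β → β < 1 / 2 → ∃ I : ℝ, I ≠ 0 ∧
            Tendsto (fun R : ℕ ↦ ∑ n ∈ Finset.Icc 0 R, freeInd S n * (n : ℝ) ^ (-β)
              - a / (1 - β) * (R : ℝ) ^ (1 - β)) atTop (𝓝 I)) ∧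
          (∀ A ε : ℝ, 0 < ε → ¬ ∃ C : ℝ, ∀ x : ℝ, 1 ≤ x →
            |(Nat.card {nm : ℕ × ℕ // (nm.1 ≠ 0 ∧ IsFree S nm.1) ∧ nm.2 ≠ 0 ∧
                (nm.1 : ℝ) * (nm.2 : ℝ) ^ (2 * α / (α + 2))⁻¹ ≤ x} : ℝ) - A * x|
              ≤ C * x ^ (2 * α / (α + 2) - ε))) :
    BrouckeDebruyneRevesz2023_thm13b := by
  intro hRH α β hα hα23 hβlo hβ
  obtain ⟨S, hS, ⟨c, C, x₀, hc, hπ⟩, a, ha, hN, hIβ, hbdry⟩ := h5 hRH α hα hα23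
  have hα1 : α < 1 := by linarith
  refine ⟨_, isSystem_delSystem_of_estimates hRH hα hα1 hβlo hβ hS hc hπ ha hN
    (fun hlt ↦ hIβ β hlt hβ) (fun heq ↦ ?_)⟩
  subst heq
  exact hbdry

/-- **BDR 2023, Theorem 1.3 (both assertions) from the analytic input of §5** (the first assertion
being proved, `BrouckeDebruyneRevesz2023_thm13a_holds`). [cite: BrouckeDebruyneRevesz2023, Theorem 1.3] -/
theorem BrouckeDebruyneRevesz2023_thm13_of_estimates
    (h5 : RiemannHypothesis → ∀ α : ℝ, 1 / 2 < α → α < 2 / 3 →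
      ∃ S : Set ℕ, (∀ p ∈ S, p.Prime) ∧
        (∃ c C x₀ : ℝ, 0 < c ∧ ∀ x : ℝ, x₀ ≤ x →
          c * (x ^ α / Real.log x) ≤ primeCountIn S x ∧
            (primeCountIn S x : ℝ) ≤ C * (x ^ α / Real.log x)) ∧
        ∃ a : ℝ, 0 < a ∧
          (∀ ε : ℝ, 0 < ε → ∃ C : ℝ, ∀ y : ℝ, 1 ≤ y →
            |(Nat.card {n : ℕ // (n ≠ 0 ∧ IsFree S n) ∧ (n : ℝ) ≤ y} : ℝ) - a * y|
              ≤ C * y ^ (2 * α / (α + 2) + ε)) ∧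
          (∀ β : ℝ, 2 * α / (α + 2) < β → β < 1 / 2 → ∃ I : ℝ, I ≠ 0 ∧
            Tendsto (fun R : ℕ ↦ ∑ n ∈ Finset.Icc 0 R, freeInd S n * (n : ℝ) ^ (-β)
              - a / (1 - β) * (R : ℝ) ^ (1 - β)) atTop (𝓝 I)) ∧
          (∀ A ε : ℝ, 0 < ε → ¬ ∃ C : ℝ, ∀ x : ℝ, 1 ≤ x →
            |(Nat.card {nm : ℕ × ℕ // (nm.1 ≠ 0 ∧ IsFree S nm.1) ∧ nm.2 ≠ 0 ∧
                (nm.1 : ℝ) * (nm.2 : ℝ) ^ (2 * α / (α + 2))⁻¹ ≤ x} : ℝ) - A * x|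
              ≤ C * x ^ (2 * α / (α + 2) - ε))) :
    BrouckeDebruyneRevesz2023_thm13 :=
  BrouckeDebruyneRevesz2023_thm13_of_thm13b (BrouckeDebruyneRevesz2023_thm13b_of_estimates h5)

end Literature.Barriers.RiemannHypothesis
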